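import Mathlib

/-!
# The degree-6 second digit on the edge branch — LEMMA B of «S2-21» (pub-hsemireg, S4-PUSH corner 2)

Kernel leg (cell `pub-hsemireg`, seat s4-search-2 gen 13) for the pencil lemmas of
`s4push/search-2/g11/LIFT2-search-2-g11.md` §5 deciding the LAST open cell of corner 2's class-level census (RESULT
«S2-19» ADDENDUM B = S4-PR-54, second code «S2-21» = S4-PR-57): the 83 twisted M2 census classes of dual type
`(2,2,3,3,3,3)` (one edge, on the slots `0, 1`).  Before this file LEMMA B was pencil ×1 + machine ×3 across
seats ∕ ×2 across exterior-algebra codes (`tight3`, `lift2`, `verify_lemmaB.py` incl. the referee's run, gs-eng-2's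
`lemmaB_x2.py`); here its displayed statement, with LEMMA A(a) (both directions, up to one clause) and LEMMA D(a),
becomes a set of ring identities checked by the kernel.

**Setting (CRITERION L digit tower, `p = 2`, `m = 2`, `q = 4`; PREREG-S2-18∕19).**  In the commutative,
torsion-free ring `Λ^{ev} = ⊕_k Λ^{2k}ℤ¹²` (`hᵢ := x_{2i}x_{2i+1}`, slot `i`), an integral 2-form `B` has integral
divided powers `B^[k]`, determined by `k!·B^[k] = B^k`.  For a gauged class with signature `(σ_k)` and dual type
`c′`, `D := Σ 2^{c′ᵢ}hᵢ` and (registered) `T_k(B) := Σ_{j≤k} (−q)^j σ_{k−j} D^[k−j] B^[j]`: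
`T₂(B) = σ₂D^[2] − 4σ₁DB + 16σ₀B^[2]`, `T₃(B) = σ₃D^[3] − 4σ₂D^[2]B + 16σ₁DB^[2] − 64σ₀B^[3]`; a
`(G, Schur)`-design forces an integral alternating `B` with `T_k(B) ≡ 0 mod 2^{m(2k−1)}` (`k = 3`: `mod 2^{10}`).
Edge type: `D = 4H + 8S₁`, `H := h₀ + h₁`, `S₁ := h₂ + ⋯ + h₅`; the 14 signatures carrying the unit have `σ₁ = 0`
(STRUCTURE LEMMA, S4-PR-42), `σ₀` odd, `σ₀ + σ₂ ≡ 0 mod 4`, `4 ∣ σ₃` — encoded as `σ₁ = 0`, `σ₀ = 2s + 1`,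
`σ₂ = 4t − σ₀`, `σ₃ = 4u`, `s t u` arbitrary.

**Atoms.**  The identities are stated over ANY commutative ring on the atoms `H, H₂ (= h₀h₁), S₁, S₂, S₃, S₄`
(`S_k = e_k(h₂, …, h₅)`; `G = h₃h₄h₅`), a cross-line element `L` (a combination of `x₀x₂, x₀x₃, x₁x₂, x₁x₃`) with
divided square `L₂ = λH₂`, and a remainder `Y` with divided powers `Y₂, Y₃`; the hypotheses `qH, zHH₂, qH₂, qS₁₁,
…, zS₄₄, zHL, zH₂L, qL, hS₁G, hFN` are the product table of these atoms in `Λ^{ev}`, derived from Mathlib's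
`ExteriorAlgebra` and the definitions in the companion file `TwoSlotFrameTable.lean` (`pairSum_*`, `slotSum_*`,
`crossLine_*`).  Auxiliary quantities (`D₂ = D^[2]`, `B₃ = B^[3]`, …) enter by explicit defining equations
(closed forms of the elementary symmetric functions of the summands), and `sq_D`, `cube_D`, `sq_B`, `cube_B`,
`sq_C`, `cube_C`, `sq_shift`, `cube_shift`, `sq_leading` certify `k!·X_k = X^k`, i.e. that these closed forms
ARE the divided powers in the torsion-free model.  All proofs: `linear_combination` with explicit cofactors
(exact reduction in the free polynomial ring; generator `s4push/search-2/g13/cert/gen4.py`, stdlib only).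

**Proved.**  `T2_digit` (LEMMA A(a), consistent direction): for `B = H + 2X`, `X = S₁ + L + ηH` (`η, λ`
arbitrary — every `0∕1` lift and more), `T₂(B) = 2⁶·P`.  `T3_digit` (LEMMA B core): `T₃(H + 2X) = 2⁸·H₂S₁ + 2⁹·Q`.
`T3_shift`: for ANY `B, Y`, `T₃(B + 4Y) = T₃(B) − 16YT₂(B) + 2⁸σ₁DY^[2] − 2¹⁰σ₀BY^[2] − 2¹²σ₀Y^[3]` (divided-power
binomial law only).  `lemmaB` (LEMMA B as registered): for `B = H + 2X + 4Y`, `Y` arbitrary,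
`T₃(B) = 2⁸·H₂S₁ + 2⁹·(explicit)`; as `H₂S₁ = Σ_{i=2}^{5} x₀x₁x₂x₃x_{2i}x_{2i+1}` is a sum of four distinct basis
6-vectors with coefficient `1`, `T₃(B) ≡ 2⁸H₂S₁ ≢ 0 mod 2⁹Λ^{ev}`, `v₂(T₃(B)) = 8 < 10`: no completion of the branch
`(B₀, X₁) = (H, S₁ + L + ηH)` meets the `k = 3` congruence — the memo's «v(T₃) = 8 < 10 for EVERY completion», the
decisive kill of the 83 classes given LEMMA A(a)'s digit-1 space.  `T3_leading_edge` (LEMMA D(a) core): for a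
leading digit `C = β₀₁h₀ + β₂₃h₁ + N` (`N` cross-line, `N^[2] = νh₀h₁`) and `σ₁ = 0`, `4 ∣ σ₃` only,
`T₃(C) = −2⁷σ₂(β₀₁ + β₂₃)·H₂S₁ + 2⁸·(explicit)`: with `σ₂` odd, `v₂(T₃(C)) = 7` iff `β₀₁ + β₂₃` odd (the twelve
depth-1 (V)-kills `(3, 7, 8)` of 28), else `2⁸ ∣ T₃(C)`; `C₂_eq_pfaffian`: `C^[2] = (β₀₁β₂₃ + ν)h₀h₁`.
`T2_leading` + `obstruction` (LEMMA A(a), inconsistent direction): for a non-degenerate leading digit `C`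
(Pfaffian `2p + 1`) and ANY first digit `X`, remainder `Y`: `T₂(C + 2X + 4Y) = 2⁵(pH₂ − HS₁ + CX) + 2⁶(explicit)`,
so the `k = 2` congruence is the digit equation `pH₂ − HS₁ + CX ∈ 2Λ^{ev}`; and if `F` is a cross line (or `0`)
with `F·N = ϖh₀h₁` and `β₂₃ + ϖ` even, any solution `X` forces `H₂S₄ = x₀⋯x₁₁ ∈ 2Λ^{ev}` — impossible; such `F`
exists for every (V)-surviving `C̄ ≠ H̄` (15 of the 16 admit no first digit).

Scope: not the tower framework ((V)-bounds, precisions — `lift2.py`), not the type enumeration or the signature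
table, not the clause «`H̄`'s digit space is exactly `S̄₁ + ⟨l̄ᵢ, H̄⟩`» of LEMMA A(a) (machine ×2 + pencil +
`verify_lemmaAC.py`), not A(b), C, D(b), E.  Honest framing: elementary commutative algebra (theorems only,
count-neutral); a kernel check of pencil steps of a CLASS-LEVEL necessary-condition sieve at the special fibre
`E⁶`; no object, no `σ` computation, no Hodge statement; nothing here bears on HC ∕ HC_CM ∕ HC_AV.
-/

namespace Summit.Ventures.HSemireg.DegreeSixSecondDigit

variable {R : Type*} [CommRing R]

section Pinning

/-! ### 1. Divided powers pinned: `k!·X_k = X^k` -/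

/-- `D·D = 2·D₂`: the closed form `D₂` of the elementary symmetric square of the six summands `4h₀, 4h₁, 8h₂, …,
8h₅` of `D = 4H + 8S₁` is `D^[2]`. -/
theorem sq_D (H H₂ S₁ S₂ D D₂ : R) (hD : D = 4 * H + 8 * S₁) (hD₂ : D₂ = 16 * H₂ + 32 * (H * S₁) +
    64 * S₂) (qH : H * H = 2 * H₂) (qS₁₁ : S₁ * S₁ = 2 * S₂) :
    D * D = 2 * D₂ := by
  linear_combination ((4) * H + (8) * S₁ + D) * hD + ((-2)) * hD₂ + (16) * qH + (64) * qS₁₁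

/-- `D·D·D = 6·D₃` (`D₃ = D^[3]`). -/
theorem cube_D (H H₂ S₁ S₂ S₃ D D₃ : R) (hD : D = 4 * H + 8 * S₁) (hD₃ : D₃ = 128 * (H₂ * S₁) + 256
    * (H * S₂) + 512 * S₃) (qH : H * H = 2 * H₂) (zHH₂ : H * H₂ = 0) (qS₁₁ : S₁ * S₁ = 2 * S₂) (qS₁₂
    : S₁ * S₂ = 3 * S₃) :
    D * D * D = 6 * D₃ := by
  linear_combination ((16) * H ^ 2 + (64) * S₁ * H + (64) * S₁ ^ 2 + (4) * D * H + (8) * D * S₁ + D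
    ^ 2) * hD + ((-6)) * hD₃ + ((64) * H + (384) * S₁) * qH + (128) * zHH₂ + ((768) * H + (512) *
    S₁) * qS₁₁ + (1024) * qS₁₂

/-- `B·B = 2·B₂` for `B = (1+2η)H + 2S₁ + 2L` (`= H + 2X`, `X = S₁ + L + ηH`): the closed form `B₂` of the
elementary symmetric square of the summands `(1+2η)h₀, (1+2η)h₁, 2hᵢ (i ≥ 2), 2L` is `B^[2]`. -/
theorem sq_B (η H H₂ S₁ S₂ L L₂ B B₂ : R) (hB : B = (1 + 2 * η) * H + 2 * S₁ + 2 * L) (hB₂ : B₂ = (1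
    + 2 * η) ^ 2 * H₂ + 2 * (1 + 2 * η) * (H * (S₁ + L)) + 4 * (S₂ + S₁ * L + L₂)) (qH : H * H = 2 *
    H₂) (qS₁₁ : S₁ * S₁ = 2 * S₂) (qL : L * L = 2 * L₂) :
    B * B = 2 * B₂ := by
  linear_combination ((2) * L + H + (2) * H * η + (2) * S₁ + B) * hB + ((-2)) * hB₂ + (1 + (4) * η +
    (4) * η ^ 2) * qH + (4) * qS₁₁ + (4) * qL

/-- `B·B·B = 6·B₃` (`B₃ = B^[3]`). -/
theorem cube_B (η lam H H₂ S₁ S₂ S₃ L L₂ B B₃ : R) (hB : B = (1 + 2 * η) * H + 2 * S₁ + 2 * L) (hB₃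
    : B₃ = 2 * (1 + 2 * η) ^ 2 * (H₂ * (S₁ + L)) + 4 * (1 + 2 * η) * (H * (S₂ + S₁ * L + L₂)) + 8 *
    (S₃ + S₂ * L + S₁ * L₂)) (qH : H * H = 2 * H₂) (zHH₂ : H * H₂ = 0) (qS₁₁ : S₁ * S₁ = 2 * S₂)
    (qS₁₂ : S₁ * S₂ = 3 * S₃) (zHL : H * L = 0) (zH₂L : H₂ * L = 0) (qL : L * L = 2 * L₂) (hL₂ : L₂
    = lam * H₂) :
    B * B * B = 6 * B₃ := by
  linear_combination ((4) * L ^ 2 + (4) * H * L + (8) * H * L * η + H ^ 2 + (4) * H ^ 2 * η + (4) *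
    H ^ 2 * η ^ 2 + (8) * S₁ * L + (4) * S₁ * H + (8) * S₁ * H * η + (4) * S₁ ^ 2 + (2) * B * L + B
    * H + (2) * B * H * η + (2) * B * S₁ + B ^ 2) * hB + ((-6)) * hB₃ + ((6) * L + (24) * L * η +
    (24) * L * η ^ 2 + H + (6) * H * η + (12) * H * η ^ 2 + (8) * H * η ^ 3 + (6) * S₁ + (24) * S₁ *
    η + (24) * S₁ * η ^ 2) * qH + (2 + (-24) * lam + (12) * η + (-48) * η * lam + (24) * η ^ 2 +
    (16) * η ^ 3) * zHH₂ + ((24) * L + (12) * H + (24) * H * η + (8) * S₁) * qS₁₁ + (16) * qS₁₂ +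
    ((12) * L + (24) * L * η) * zHL + ((16) * lam) * zH₂L + ((8) * L + (24) * S₁) * qL + ((16) * L +
    (-24) * H + (-48) * H * η) * hL₂

end Pinning

section Digits

/-! ### 2. The degree-4 digit, LEMMA B, the `Y`-shift -/

/-- **LEMMA A(a), consistent direction (degree 4).** `σ₁ = 0`, `σ₀ = 2s + 1`, `σ₂ = 4t − σ₀`; `B = H + 2X`, `X =
S₁ + L + ηH` (`η, λ, s, t` arbitrary): `T₂(B) = 2⁶·P` with the displayed `P` — the `k = 2` design congruence
`T₂ ≡ 0 mod 2⁶` holds on the whole digit-1 space. -/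
theorem T2_digit (σ₀ σ₁ σ₂ s t η lam H H₂ S₁ S₂ L L₂ D D₂ B B₂ T₂ : R) (hT₂ : T₂ = σ₂ * D₂ - 4 * σ₁
    * (D * B) + 16 * σ₀ * B₂) (hD : D = 4 * H + 8 * S₁) (hD₂ : D₂ = 16 * H₂ + 32 * (H * S₁) + 64 *
    S₂) (hB : B = (1 + 2 * η) * H + 2 * S₁ + 2 * L) (hB₂ : B₂ = (1 + 2 * η) ^ 2 * H₂ + 2 * (1 + 2 *
    η) * (H * (S₁ + L)) + 4 * (S₂ + S₁ * L + L₂)) (qH : H * H = 2 * H₂) (qS₁₁ : S₁ * S₁ = 2 * S₂)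
    (zHL : H * L = 0) (hL₂ : L₂ = lam * H₂) (hσ₁ : σ₁ = 0) (hσ₂ : σ₂ = 4 * t - σ₀) (hσ₀ : σ₀ = 2 * s
    + 1) :
    T₂ = 64 * (((1 + 2 * s) * (η ^ 2 + η + lam) + t) * H₂ + ((1 + 2 * s) * η + 2 * t) * (H * S₁) + 4
      * t * S₂ + (1 + 2 * s) * (L * S₁)) := by
  linear_combination (1) * hT₂ + ((-4) * B * σ₁) * hD + (σ₂) * hD₂ + ((-16) * H * σ₁ + (-32) * S₁ *
    σ₁) * hB + ((16) * σ₀) * hB₂ + ((-16) * σ₁ + (-32) * σ₁ * η) * qH + ((-64) * σ₁) * qS₁₁ + ((-32)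
    * σ₁ + (32) * σ₀ + (64) * σ₀ * η) * zHL + ((64) * σ₀) * hL₂ + ((-32) * H₂ + (-64) * H₂ * η +
    (-64) * S₁ * L + (-64) * S₁ * H + (-64) * S₁ * H * η + (-128) * S₂) * hσ₁ + ((16) * H₂ + (32) *
    S₁ * H + (64) * S₂) * hσ₂ + ((64) * H₂ * lam + (64) * H₂ * η + (64) * H₂ * η ^ 2 + (64) * S₁ * L
    + (64) * S₁ * H * η) * hσ₀

/-- **LEMMA B, core identity (degree 6).** `σ₁ = 0`, `σ₀ = 2s + 1`, `σ₂ = 4t − σ₀`, `σ₃ = 4u`; `B = H + 2X`, `X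
= S₁ + L + ηH`: `T₃(B) = 2⁸·H₂S₁ + 2⁹·Q` with the displayed `Q`, for ARBITRARY `η, λ, s, t, u`.  In
`Λ^{ev}ℤ¹²`, `H₂S₁ = h₀h₁(h₂ + h₃ + h₄ + h₅)` is the sum of four distinct basis 6-vectors with coefficient
`1`, so `T₃(B) ≡ 2⁸·H₂S₁ ≢ 0 mod 2⁹`: `v₂(T₃(B)) = 8`. -/
theorem T3_digit (σ₀ σ₁ σ₂ σ₃ s t u η lam H H₂ S₁ S₂ S₃ L L₂ D D₂ D₃ B B₂ B₃ T₃ : R) (hT₃ : T₃ = σ₃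
    * D₃ - 4 * σ₂ * (D₂ * B) + 16 * σ₁ * (D * B₂) - 64 * σ₀ * B₃) (hD : D = 4 * H + 8 * S₁) (hD₂ :
    D₂ = 16 * H₂ + 32 * (H * S₁) + 64 * S₂) (hD₃ : D₃ = 128 * (H₂ * S₁) + 256 * (H * S₂) + 512 * S₃)
    (hB : B = (1 + 2 * η) * H + 2 * S₁ + 2 * L) (hB₂ : B₂ = (1 + 2 * η) ^ 2 * H₂ + 2 * (1 + 2 * η) *
    (H * (S₁ + L)) + 4 * (S₂ + S₁ * L + L₂)) (hB₃ : B₃ = 2 * (1 + 2 * η) ^ 2 * (H₂ * (S₁ + L)) + 4 *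
    (1 + 2 * η) * (H * (S₂ + S₁ * L + L₂)) + 8 * (S₃ + S₂ * L + S₁ * L₂)) (qH : H * H = 2 * H₂)
    (zHH₂ : H * H₂ = 0) (qS₁₁ : S₁ * S₁ = 2 * S₂) (qS₁₂ : S₁ * S₂ = 3 * S₃) (zHL : H * L = 0) (zH₂L
    : H₂ * L = 0) (hL₂ : L₂ = lam * H₂) (hσ₁ : σ₁ = 0) (hσ₂ : σ₂ = 4 * t - σ₀) (hσ₀ : σ₀ = 2 * s +
    1) (hσ₃ : σ₃ = 4 * u) :
    T₃ = 256 * (H₂ * S₁) + 512 * ((s + u - 3 * t - 4 * t * η - (1 + 2 * s) * (η ^ 2 + lam)) * (H₂ *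
      S₁) + (1 + 2 * s + 2 * u - 6 * t - 4 * t * η) * (H * S₂) + (2 + 4 * s + 4 * u - 12 * t) * S₃ -
      4 * t * (L * S₂)) := by
  linear_combination (1) * hT₃ + ((16) * B₂ * σ₁) * hD + ((-4) * B * σ₂) * hD₂ + (σ₃) * hD₃ + ((-64)
    * H₂ * σ₂ + (-128) * S₁ * H * σ₂ + (-256) * S₂ * σ₂) * hB + ((64) * H * σ₁ + (128) * S₁ * σ₁) *
    hB₂ + ((-64) * σ₀) * hB₃ + ((128) * L * σ₁ + (256) * L * σ₁ * η + (-128) * S₁ * σ₂ + (-256) * S₁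
    * σ₂ * η + (128) * S₁ * σ₁ + (256) * S₁ * σ₁ * η) * qH + ((-64) * σ₂ + (-128) * σ₂ * η + (64) *
    σ₁ + (256) * σ₁ * lam + (256) * σ₁ * η + (256) * σ₁ * η ^ 2 + (-256) * σ₀ * lam + (-512) * σ₀ *
    η * lam) * zHH₂ + ((512) * L * σ₁ + (-256) * H * σ₂ + (256) * H * σ₁ + (512) * H * σ₁ * η) *
    qS₁₁ + ((-512) * σ₂ + (512) * σ₁) * qS₁₂ + ((-256) * S₁ * σ₂ + (512) * S₁ * σ₁ + (512) * S₁ * σ₁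
    * η + (-256) * S₁ * σ₀ + (-512) * S₁ * σ₀ * η) * zHL + ((-128) * σ₂ + (256) * σ₁ + (512) * σ₁ *
    η + (-128) * σ₀ + (-512) * σ₀ * η + (-512) * σ₀ * η ^ 2) * zH₂L + ((256) * H * σ₁ + (-256) * H *
    σ₀ + (-512) * H * σ₀ * η + (512) * S₁ * σ₁ + (-512) * S₁ * σ₀) * hL₂ + ((384) * S₁ * H₂ + (512)
    * S₁ * H₂ * lam + (1024) * S₁ * H₂ * η + (512) * S₁ * H₂ * η ^ 2 + (1024) * S₂ * L + (768) * S₂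
    * H + (1024) * S₂ * H * η + (1536) * S₃) * hσ₁ + ((-384) * S₁ * H₂ + (-512) * S₁ * H₂ * η +
    (-512) * S₂ * L + (-768) * S₂ * H + (-512) * S₂ * H * η + (-1536) * S₃) * hσ₂ + ((256) * S₁ * H₂
    + (-512) * S₁ * H₂ * lam + (-512) * S₁ * H₂ * η ^ 2 + (512) * S₂ * H + (1024) * S₃) * hσ₀ +
    ((128) * S₁ * H₂ + (256) * S₂ * H + (512) * S₃) * hσ₃

/-- **The `Y`-terms (divided-power binomial step).** For ANY `B, Y` with divided powers `B₂, B₃, Y₂, Y₃`, the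
divided powers of `B + 4Y` are `E₂ = B₂ + 4BY + 16Y₂`, `E₃ = B₃ + 4B₂Y + 16BY₂ + 64Y₃` (pinned by `sq_shift`
∕ `cube_shift`), and identically `T₃(B + 4Y) = T₃(B) − 16·Y·T₂(B) + 2⁸σ₁·D·Y₂ − 2¹⁰σ₀·B·Y₂ − 2¹²σ₀·Y₃` — no
table relation and no hypothesis on `σ` enters. -/
theorem T3_shift (σ₀ σ₁ σ₂ σ₃ D D₂ D₃ B B₂ B₃ Y Y₂ Y₃ E₂ E₃ T₂ T₃ T₃' : R) (hT₃' : T₃' = σ₃ * D₃ - 4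
    * σ₂ * (D₂ * (B + 4 * Y)) + 16 * σ₁ * (D * E₂) - 64 * σ₀ * E₃) (hT₃ : T₃ = σ₃ * D₃ - 4 * σ₂ *
    (D₂ * B) + 16 * σ₁ * (D * B₂) - 64 * σ₀ * B₃) (hT₂ : T₂ = σ₂ * D₂ - 4 * σ₁ * (D * B) + 16 * σ₀ *
    B₂) (hE₂ : E₂ = B₂ + 4 * (B * Y) + 16 * Y₂) (hE₃ : E₃ = B₃ + 4 * (B₂ * Y) + 16 * (B * Y₂) + 64 *
    Y₃) :
    T₃' = T₃ - 16 * (Y * T₂) + 256 * σ₁ * (D * Y₂) - 1024 * σ₀ * (B * Y₂) - 4096 * σ₀ * Y₃ := by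
  linear_combination (1) * hT₃' + ((-1)) * hT₃ + ((16) * Y) * hT₂ + ((16) * D * σ₁) * hE₂ + ((-64) *
    σ₀) * hE₃

/-- Pinning of `E₂`: `B·B = 2B₂`, `Y·Y = 2Y₂` ⟹ `(B + 4Y)·(B + 4Y) = 2·E₂`. -/
theorem sq_shift (B B₂ Y Y₂ E₂ : R) (hE₂ : E₂ = B₂ + 4 * (B * Y) + 16 * Y₂) (hB₂ : B * B = 2 * B₂)
    (hY₂ : Y * Y = 2 * Y₂) :
    (B + 4 * Y) * (B + 4 * Y) = 2 * E₂ := by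
  linear_combination ((-2)) * hE₂ + (1) * hB₂ + (16) * hY₂

/-- Pinning of `E₃`: `B·B = 2B₂`, `B·B·B = 6B₃`, `Y·Y = 2Y₂`, `Y·Y·Y = 6Y₃` ⟹ `(B + 4Y)³ = 6·E₃`. -/
theorem cube_shift (B B₂ B₃ Y Y₂ Y₃ E₃ : R) (hE₃ : E₃ = B₃ + 4 * (B₂ * Y) + 16 * (B * Y₂) + 64 * Y₃)
    (hB₃ : B * B * B = 6 * B₃) (hB₂ : B * B = 2 * B₂) (hY₃ : Y * Y * Y = 6 * Y₃) (hY₂ : Y * Y = 2 *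
    Y₂) :
    (B + 4 * Y) * (B + 4 * Y) * (B + 4 * Y) = 6 * E₃ := by
  linear_combination ((-6)) * hE₃ + (1) * hB₃ + ((12) * Y) * hB₂ + (64) * hY₃ + ((48) * B) * hY₂

/-- **LEMMA B as registered («S2-21» §5; PREREG-S2-19 ADDENDUM B, the `(2,2,3,3,3,3)` edge unit).** `σ₁ = 0`,
`σ₀ = 2s + 1` (odd), `σ₂ = 4t − σ₀` (`σ₀ + σ₂ ≡ 0 mod 4`), `σ₃ = 4u` (`4 ∣ σ₃`); leading digit `B₀ = H`,
first digit `X = S₁ + L + ηH`, ARBITRARY remainder `Y` with divided powers `Y₂, Y₃` (`E₂, E₃` those of `B =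
H + 2X + 4Y`): `T₃(B) = 2⁸·H₂S₁ + 2⁹·(explicit)`.  In `Λ^{ev}ℤ¹²`: `T₃(B) ≡ 2⁸(h₀h₁h₂ + h₀h₁h₃ + h₀h₁h₄ +
h₀h₁h₅) ≢ 0 mod 2⁹`, `v₂(T₃(B)) = 8 < 10 = v₂(2^{m(2k−1)})` at `m = 2`, `k = 3`: no completion of the branch
satisfies the `k = 3` design congruence — given LEMMA A(a)'s digit-1 space, the 83 edge-type M2 classes are
CLASS-DEAD under CRITERION L. -/
theorem lemmaB (σ₀ σ₁ σ₂ σ₃ s t u η lam H H₂ S₁ S₂ S₃ L L₂ D D₂ D₃ B B₂ B₃ Y Y₂ Y₃ E₂ E₃ T₃' : R)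
    (hT₃' : T₃' = σ₃ * D₃ - 4 * σ₂ * (D₂ * (B + 4 * Y)) + 16 * σ₁ * (D * E₂) - 64 * σ₀ * E₃) (hE₂ :
    E₂ = B₂ + 4 * (B * Y) + 16 * Y₂) (hE₃ : E₃ = B₃ + 4 * (B₂ * Y) + 16 * (B * Y₂) + 64 * Y₃) (hD :
    D = 4 * H + 8 * S₁) (hD₂ : D₂ = 16 * H₂ + 32 * (H * S₁) + 64 * S₂) (hD₃ : D₃ = 128 * (H₂ * S₁) +
    256 * (H * S₂) + 512 * S₃) (hB : B = (1 + 2 * η) * H + 2 * S₁ + 2 * L) (hB₂ : B₂ = (1 + 2 * η) ^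
    2 * H₂ + 2 * (1 + 2 * η) * (H * (S₁ + L)) + 4 * (S₂ + S₁ * L + L₂)) (hB₃ : B₃ = 2 * (1 + 2 * η)
    ^ 2 * (H₂ * (S₁ + L)) + 4 * (1 + 2 * η) * (H * (S₂ + S₁ * L + L₂)) + 8 * (S₃ + S₂ * L + S₁ *
    L₂)) (qH : H * H = 2 * H₂) (zHH₂ : H * H₂ = 0) (qS₁₁ : S₁ * S₁ = 2 * S₂) (qS₁₂ : S₁ * S₂ = 3 *
    S₃) (zHL : H * L = 0) (zH₂L : H₂ * L = 0) (hL₂ : L₂ = lam * H₂) (hσ₁ : σ₁ = 0) (hσ₂ : σ₂ = 4 * t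
    - σ₀) (hσ₀ : σ₀ = 2 * s + 1) (hσ₃ : σ₃ = 4 * u) :
    T₃' = 256 * (H₂ * S₁) + 512 * ((s + u - 3 * t - 4 * t * η - (1 + 2 * s) * (η ^ 2 + lam)) * (H₂ *
      S₁) + (1 + 2 * s + 2 * u - 6 * t - 4 * t * η) * (H * S₂) + (2 + 4 * s + 4 * u - 12 * t) * S₃ -
      4 * t * (L * S₂) - 2 * (Y * (((1 + 2 * s) * (η ^ 2 + η + lam) + t) * H₂ + ((1 + 2 * s) * η + 2
      * t) * (H * S₁) + 4 * t * S₂ + (1 + 2 * s) * (L * S₁))) - 2 * σ₀ * (B * Y₂) - 8 * σ₀ * Y₃) :=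
      by
  linear_combination (T3_shift σ₀ σ₁ σ₂ σ₃ D D₂ D₃ B B₂ B₃ Y Y₂ Y₃ E₂ E₃ (σ₂ * D₂ - 4 * σ₁ * (D * B)
    + 16 * σ₀ * B₂) (σ₃ * D₃ - 4 * σ₂ * (D₂ * B) + 16 * σ₁ * (D * B₂) - 64 * σ₀ * B₃) T₃' hT₃' rfl
    rfl hE₂ hE₃) + (T3_digit σ₀ σ₁ σ₂ σ₃ s t u η lam H H₂ S₁ S₂ S₃ L L₂ D D₂ D₃ B B₂ B₃ (σ₃ * D₃ - 4
    * σ₂ * (D₂ * B) + 16 * σ₁ * (D * B₂) - 64 * σ₀ * B₃) rfl hD hD₂ hD₃ hB hB₂ hB₃ qH zHH₂ qS₁₁ qS₁₂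
    zHL zH₂L hL₂ hσ₁ hσ₂ hσ₀ hσ₃) - 16 * Y * (T2_digit σ₀ σ₁ σ₂ s t η lam H H₂ S₁ S₂ L L₂ D D₂ B B₂
    (σ₂ * D₂ - 4 * σ₁ * (D * B) + 16 * σ₀ * B₂) rfl hD hD₂ hB hB₂ qH qS₁₁ zHL hL₂ hσ₁ hσ₂ hσ₀) +
    (256 * (D * Y₂)) * hσ₁

end Digits

section Edge

/-! ### 3. LEMMA D(a): the leading digits on the edge -/

/-- **LEMMA D(a), core identity (the depth-1 (V)-test of the leading digits on the edge).** For a leading digit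
`C = β₀₁h₀ + β₂₃h₁ + N` (`N` its cross-line part: `h₀N = h₁N = 0`, `N·N = 2N₂`, `N₂ = ν h₀h₁`; arbitrary
`β₀₁, β₂₃, ν`), with `C₂, C₃` the closed forms of `C^[2], C^[3]` (`sq_C`, `cube_C`), and `σ₁ = 0`, `σ₃ = 4u`
ONLY: `T₃(C) = −2⁷σ₂(β₀₁ + β₂₃)·H₂S₁ + 2⁸·(explicit)`.  So for `σ₂` odd, `v₂(T₃(C)) = 7` iff `β₀₁ + β₂₃` is
odd — the twelve depth-1 (V)-kills `(k, v, g) = (3, 7, 8)` among the 28 non-degenerate leading digits of the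
memo — and `2⁸ ∣ T₃(C)` otherwise. -/
theorem T3_leading_edge (h₀ h₁ σ₀ σ₁ σ₂ σ₃ u nu β₀₁ β₂₃ H H₂ S₁ S₂ S₃ N N₂ D D₂ D₃ C C₂ C₃ U₃ : R)
    (hU₃ : U₃ = σ₃ * D₃ - 4 * σ₂ * (D₂ * C) + 16 * σ₁ * (D * C₂) - 64 * σ₀ * C₃) (hD : D = 4 * H + 8
    * S₁) (hD₂ : D₂ = 16 * H₂ + 32 * (H * S₁) + 64 * S₂) (hD₃ : D₃ = 128 * (H₂ * S₁) + 256 * (H *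
    S₂) + 512 * S₃) (hC : C = β₀₁ * h₀ + β₂₃ * h₁ + N) (hC₂ : C₂ = β₀₁ * β₂₃ * (h₀ * h₁) + (β₀₁ * h₀
    + β₂₃ * h₁) * N + N₂) (hC₃ : C₃ = β₀₁ * β₂₃ * (h₀ * h₁) * N + (β₀₁ * h₀ + β₂₃ * h₁) * N₂) (hH :
    H = h₀ + h₁) (hH₂ : H₂ = h₀ * h₁) (qh₀ : h₀ * h₀ = 0) (qh₁ : h₁ * h₁ = 0) (zh₀N : h₀ * N = 0)
    (zh₁N : h₁ * N = 0) (hN₂ : N₂ = nu * (h₀ * h₁)) (hσ₁ : σ₁ = 0) (hσ₃ : σ₃ = 4 * u) :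
    U₃ = (-128) * (σ₂ * (β₀₁ + β₂₃)) * (H₂ * S₁) + 256 * (2 * u * (H₂ * S₁) + 4 * u * (H * S₂) + 8 *
      u * S₃ - σ₂ * (C * S₂)) := by
  linear_combination (1) * hU₃ + ((16) * C₂ * σ₁) * hD + ((-4) * C * σ₂) * hD₂ + (σ₃) * hD₃ + ((-64)
    * H₂ * σ₂ + (-128) * S₁ * H * σ₂) * hC + ((64) * H * σ₁ + (128) * S₁ * σ₁) * hC₂ + ((-64) * σ₀)
    * hC₃ + ((64) * h₀ * h₁ * σ₁ * β₀₁ * β₂₃ + (64) * N * h₁ * σ₁ * β₂₃ + (64) * N * h₀ * σ₁ * β₀₁ +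
    (-128) * S₁ * h₁ * σ₂ * β₂₃ + (-128) * S₁ * h₀ * σ₂ * β₀₁ + (-128) * S₁ * N * σ₂ + (-1024) * S₂
    * u + (256) * S₂ * σ₃ + (64) * N₂ * σ₁) * hH + ((-64) * h₁ * σ₂ * β₂₃ + (-64) * h₀ * σ₂ * β₀₁ +
    (-64) * N * σ₂ + (-512) * S₁ * u + (128) * S₁ * σ₃ + (128) * S₁ * σ₂ * β₂₃ + (128) * S₁ * σ₂ *
    β₀₁) * hH₂ + ((-64) * h₁ * σ₂ * β₀₁ + (64) * h₁ * σ₁ * β₀₁ * β₂₃ + (64) * h₁ * σ₁ * nu + (-64) *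
    h₁ * σ₀ * nu * β₀₁ + (64) * N * σ₁ * β₀₁ + (-128) * S₁ * σ₂ * β₀₁) * qh₀ + ((-64) * h₀ * σ₂ *
    β₂₃ + (64) * h₀ * σ₁ * β₀₁ * β₂₃ + (64) * h₀ * σ₁ * nu + (-64) * h₀ * σ₀ * nu * β₂₃ + (64) * N *
    σ₁ * β₂₃ + (-128) * S₁ * σ₂ * β₂₃) * qh₁ + ((-64) * h₁ * σ₂ + (64) * h₁ * σ₁ * β₂₃ + (64) * h₁ *
    σ₁ * β₀₁ + (-64) * h₁ * σ₀ * β₀₁ * β₂₃ + (-128) * S₁ * σ₂ + (128) * S₁ * σ₁ * β₀₁) * zh₀N +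
    ((-128) * S₁ * σ₂ + (128) * S₁ * σ₁ * β₂₃) * zh₁N + ((64) * h₁ * σ₁ + (-64) * h₁ * σ₀ * β₂₃ +
    (64) * h₀ * σ₁ + (-64) * h₀ * σ₀ * β₀₁ + (128) * S₁ * σ₁) * hN₂ + ((128) * S₁ * h₀ * h₁ * β₀₁ *
    β₂₃ + (128) * S₁ * h₀ * h₁ * nu) * hσ₁ + ((128) * S₁ * h₀ * h₁ + (256) * S₂ * h₁ + (256) * S₂ *
    h₀ + (512) * S₃) * hσ₃

/-- Pinning: `C·C = 2C₂` (`C₂ = C^[2]`). -/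
theorem sq_C (h₀ h₁ β₀₁ β₂₃ N N₂ C C₂ : R) (hC : C = β₀₁ * h₀ + β₂₃ * h₁ + N) (hC₂ : C₂ = β₀₁ * β₂₃
    * (h₀ * h₁) + (β₀₁ * h₀ + β₂₃ * h₁) * N + N₂) (qh₀ : h₀ * h₀ = 0) (qh₁ : h₁ * h₁ = 0) (qN : N *
    N = 2 * N₂) :
    C * C = 2 * C₂ := by
  linear_combination (h₁ * β₂₃ + h₀ * β₀₁ + N + C) * hC + ((-2)) * hC₂ + (β₀₁ ^ 2) * qh₀ + (β₂₃ ^ 2)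
    * qh₁ + (1) * qN

/-- Pinning: `C·C·C = 6C₃` (`C₃ = C^[3]`). -/
theorem cube_C (h₀ h₁ nu β₀₁ β₂₃ N N₂ C C₃ : R) (hC : C = β₀₁ * h₀ + β₂₃ * h₁ + N) (hC₃ : C₃ = β₀₁ *
    β₂₃ * (h₀ * h₁) * N + (β₀₁ * h₀ + β₂₃ * h₁) * N₂) (qh₀ : h₀ * h₀ = 0) (qh₁ : h₁ * h₁ = 0) (zh₀N
    : h₀ * N = 0) (zh₁N : h₁ * N = 0) (qN : N * N = 2 * N₂) (hN₂ : N₂ = nu * (h₀ * h₁)) :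
    C * C * C = 6 * C₃ := by
  linear_combination (h₁ ^ 2 * β₂₃ ^ 2 + (2) * h₀ * h₁ * β₀₁ * β₂₃ + h₀ ^ 2 * β₀₁ ^ 2 + (2) * N * h₁
    * β₂₃ + (2) * N * h₀ * β₀₁ + N ^ 2 + C * h₁ * β₂₃ + C * h₀ * β₀₁ + C * N + C ^ 2) * hC + ((-6))
    * hC₃ + ((3) * h₁ * β₀₁ ^ 2 * β₂₃ + (-6) * h₁ * nu * β₀₁ + h₀ * β₀₁ ^ 3 + (3) * N * β₀₁ ^ 2) *
    qh₀ + (h₁ * β₂₃ ^ 3 + (3) * h₀ * β₀₁ * β₂₃ ^ 2 + (-6) * h₀ * nu * β₂₃ + (3) * N * β₂₃ ^ 2) * qh₁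
    + ((2) * h₁ * nu + (3) * N * β₀₁) * zh₀N + ((3) * N * β₂₃) * zh₁N + (N) * qN + ((-6) * h₁ * β₂₃
    + (-6) * h₀ * β₀₁ + (2) * N) * hN₂

/-- After the relations, `C^[2] = (β₀₁β₂₃ + ν)·h₀h₁` — the Pfaffian of the leading digit (`ν = β₀₃β₁₂ − β₀₂β₁₃`
for `N = β₀₂l₁ + β₀₃l₂ + β₁₂l₃ + β₁₃l₄`, by `crossLine_dividedSquare`), the coordinate of
`DividedSquareLemma.sq_eq_two_mul_pfaffian_smul`. -/
theorem C₂_eq_pfaffian (h₀ h₁ nu β₀₁ β₂₃ N N₂ C₂ : R) (hC₂ : C₂ = β₀₁ * β₂₃ * (h₀ * h₁) + (β₀₁ * h₀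
    + β₂₃ * h₁) * N + N₂) (zh₀N : h₀ * N = 0) (zh₁N : h₁ * N = 0) (hN₂ : N₂ = nu * (h₀ * h₁)) :
    C₂ = (β₀₁ * β₂₃ + nu) * (h₀ * h₁) := by
  linear_combination (1) * hC₂ + (β₀₁) * zh₀N + (β₂₃) * zh₁N + (1) * hN₂

/-- `C^[3] = 0` (a 2-form on the four basis vectors of two slots). -/
theorem C₃_eq_zero (h₀ h₁ nu β₀₁ β₂₃ N N₂ C₃ : R) (hC₃ : C₃ = β₀₁ * β₂₃ * (h₀ * h₁) * N + (β₀₁ * h₀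
    + β₂₃ * h₁) * N₂) (qh₀ : h₀ * h₀ = 0) (qh₁ : h₁ * h₁ = 0) (zh₀N : h₀ * N = 0) (hN₂ : N₂ = nu *
    (h₀ * h₁)) :
    C₃ = 0 := by
  linear_combination (1) * hC₃ + (h₁ * nu * β₀₁) * qh₀ + (h₀ * nu * β₂₃) * qh₁ + (h₁ * β₀₁ * β₂₃) *
    zh₀N + (h₁ * β₂₃ + h₀ * β₀₁) * hN₂

end Edge

section Obstruction

/-! ### 4. LEMMA A(a), inconsistent direction: no first digit off `H̄` -/

/-- Pinning of `E` (the divided square of `C + 2X + 4Y` for ANY first digit `X` and remainder `Y` with divided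
squares `X₂, Y₂`): `C·C = 2C₂`, `X·X = 2X₂`, `Y·Y = 2Y₂` ⟹ `(C + 2X + 4Y)² = 2E`. -/
theorem sq_leading (C C₂ X X₂ Y Y₂ E : R) (hE : E = C₂ + 2 * (C * X) + 4 * (C * Y) + 4 * X₂ + 8 * (X
    * Y) + 16 * Y₂) (hC₂ : C * C = 2 * C₂) (hX₂ : X * X = 2 * X₂) (hY₂ : Y * Y = 2 * Y₂) :
    (C + 2 * X + 4 * Y) * (C + 2 * X + 4 * Y) = 2 * E := by
  linear_combination ((-2)) * hE + (1) * hC₂ + (4) * hX₂ + (16) * hY₂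

/-- **The degree-4 digit equation for a general leading digit on the edge (LEMMA A(a), setting).** `C = β₀₁h₀ +
β₂₃h₁ + N` non-degenerate: Pfaffian `β₀₁β₂₃ + ν = 2p + 1` odd (`hPf`); `σ₁ = 0`, `σ₀ = 2s + 1`, `σ₂ = 4t −
σ₀`; `X` ANY first digit, `Y` ANY remainder (divided squares `X₂, Y₂`; `E` = that of `C + 2X + 4Y`,
`sq_leading`).  Then `T₂(C + 2X + 4Y) = 2⁵·(pH₂ − HS₁ + CX) + 2⁶·(explicit)`: in the torsion-free
`Λ^{ev}ℤ¹²` the `k = 2` congruence `T₂ ≡ 0 mod 2⁶` holds iff `pH₂ − HS₁ + CX ∈ 2Λ^{ev}` — the memo's digit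
equation `C̄∧X̄ = εh̄₀h̄₁ + H̄S̄₁` over `𝔽₂` with `ε = p mod 2 = (Pf − 1)∕2`. -/
theorem T2_leading (h₀ h₁ σ₀ σ₁ σ₂ s t p nu β₀₁ β₂₃ H H₂ S₁ S₂ N N₂ D D₂ C C₂ X X₂ Y Y₂ E T₂ : R)
    (hT₂ : T₂ = σ₂ * D₂ - 4 * σ₁ * (D * (C + 2 * X + 4 * Y)) + 16 * σ₀ * E) (hE : E = C₂ + 2 * (C *
    X) + 4 * (C * Y) + 4 * X₂ + 8 * (X * Y) + 16 * Y₂) (hD : D = 4 * H + 8 * S₁) (hD₂ : D₂ = 16 * H₂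
    + 32 * (H * S₁) + 64 * S₂) (hC : C = β₀₁ * h₀ + β₂₃ * h₁ + N) (hC₂ : C₂ = β₀₁ * β₂₃ * (h₀ * h₁)
    + (β₀₁ * h₀ + β₂₃ * h₁) * N + N₂) (hH : H = h₀ + h₁) (hH₂ : H₂ = h₀ * h₁) (qh₀ : h₀ * h₀ = 0)
    (qh₁ : h₁ * h₁ = 0) (zh₀N : h₀ * N = 0) (zh₁N : h₁ * N = 0) (hN₂ : N₂ = nu * (h₀ * h₁)) (hPf :
    nu = 2 * p + 1 - β₀₁ * β₂₃) (hσ₁ : σ₁ = 0) (hσ₂ : σ₂ = 4 * t - σ₀) (hσ₀ : σ₀ = 2 * s + 1) :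
    T₂ = 32 * (p * H₂ - H * S₁ + C * X) + 64 * ((s * p + t) * H₂ + (2 * t - s) * (H * S₁) + s * (C *
      X) + σ₂ * S₂ + σ₀ * (C * Y + X₂ + 2 * (X * Y) + 4 * Y₂)) := by
  linear_combination (1) * hT₂ + ((16) * σ₀) * hE + ((-8) * X * σ₁ + (-16) * Y * σ₁ + (-4) * C * σ₁)
    * hD + (σ₂) * hD₂ + ((-32) * X + (-64) * X * s + (32) * X * σ₀ + (-16) * H * σ₁ + (-32) * S₁ *
    σ₁) * hC + ((16) * σ₀) * hC₂ + ((-16) * h₁ * σ₁ * β₂₃ + (-16) * h₀ * σ₁ * β₀₁ + (-16) * N * σ₁ +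
    (-32) * X * σ₁ + (-64) * Y * σ₁ + (32) * S₁ + (-128) * S₁ * t + (64) * S₁ * s + (32) * S₁ * σ₂)
    * hH + ((-32) * p + (-64) * t + (-64) * s * p + (16) * σ₂) * hH₂ + ((-16) * σ₁ * β₀₁) * qh₀ +
    ((-16) * σ₁ * β₂₃) * qh₁ + ((-16) * σ₁ + (16) * σ₀ * β₀₁) * zh₀N + ((-16) * σ₁ + (16) * σ₀ *
    β₂₃) * zh₁N + ((16) * σ₀) * hN₂ + ((16) * h₀ * h₁ * σ₀) * hPf + ((-16) * h₀ * h₁ * β₂₃ + (-16) *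
    h₀ * h₁ * β₀₁ + (-32) * X * h₁ + (-32) * X * h₀ + (-64) * Y * h₁ + (-64) * Y * h₀ + (-32) * S₁ *
    h₁ * β₂₃ + (-32) * S₁ * h₀ * β₀₁ + (-32) * S₁ * N + (-64) * S₁ * X + (-128) * S₁ * Y) * hσ₁ +
    ((16) * h₀ * h₁ + (32) * S₁ * h₁ + (32) * S₁ * h₀) * hσ₂ + ((32) * h₀ * h₁ * p + (32) * X * h₁ *
    β₂₃ + (32) * X * h₀ * β₀₁ + (32) * X * N + (-32) * S₁ * h₁ + (-32) * S₁ * h₀) * hσ₀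

/-- **LEMMA A(a), inconsistent direction (the functional `(h₀ + F)·h₃h₄h₅`).** Let `C = β₀₁h₀ + β₂₃h₁ + N` be a
leading digit and `F` a cross-line element with `h₀F = h₁F = 0` and `F·N = ϖ·h₀h₁` (`crossLine_pair*` in
`TwoSlotFrameTable`; `F = 0, ϖ = 0` allowed) such that `β₂₃ + ϖ = 2m` is EVEN; `G := h₃h₄h₅` (`S₁G = S₄`).
If some first digit `X` solves the digit equation, `pH₂ − HS₁ + CX = 2W` (`X, W` ARBITRARY ring elements),
then the top class is divisible by two: `H₂S₄ = 2·(explicit)`.  In `Λ^{ev}ℤ¹²`, `H₂S₄ = x₀x₁⋯x₁₁` has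
coefficient `1`, so NO such `X` exists.  Coverage of the 16 (V)-surviving non-degenerate `C̄` (`β₀₁ ≡ β₂₃
mod 2`): `β₀₁, β₂₃` even ⟹ take `F = 0`; `β₀₁, β₂₃` odd and `C̄ ≠ H̄` ⟹ some cross coefficient `nᵢ` of `N`
is odd, take `F` the complementary cross line (`ϖ = ∓nᵢ` odd) — so exactly `C̄ = H̄` escapes: 15 of 16
leading digits admit no first digit (the memo's «15∕16 inconsistent», machine `lift2` = g10,
`verify_lemmaAC.py`).  That `H̄`'s digit space is exactly the displayed `S̄₁ + ⟨l̄₁, …, l̄₄, H̄⟩` (used by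
`lemmaB`) is LEMMA A(a)'s remaining clause and is not proved here. -/
theorem obstruction (h₀ h₁ p m ϖ β₀₁ β₂₃ H H₂ S₁ S₄ G N F C X W : R) (hC : C = β₀₁ * h₀ + β₂₃ * h₁ +
    N) (hH : H = h₀ + h₁) (hH₂ : H₂ = h₀ * h₁) (qh₀ : h₀ * h₀ = 0) (zh₀N : h₀ * N = 0) (zh₀F : h₀ *
    F = 0) (zh₁F : h₁ * F = 0) (hFN : F * N = ϖ * (h₀ * h₁)) (hS₁G : S₁ * G = S₄) (hX : p * H₂ - H *
    S₁ + C * X = 2 * W) (hm : β₂₃ + ϖ = 2 * m) :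
    H₂ * S₄ = 2 * (m * (H₂ * (X * G)) - (h₀ + F) * (G * W)) := by
  linear_combination (X * G * h₀ + X * G * F) * hC + ((-1) * S₁ * G * h₀ + (-1) * S₁ * G * F) * hH +
    (G * h₀ * p + G * F * p + (-2) * X * G * m + S₄) * hH₂ + (G * h₁ * p + X * G * β₀₁ + (-1) * S₁ *
    G) * qh₀ + (X * G) * zh₀N + (G * h₁ * p + X * G * β₀₁ + (-1) * S₁ * G) * zh₀F + (X * G * β₂₃ +
    (-1) * S₁ * G) * zh₁F + (X * G) * hFN + ((-1) * h₀ * h₁) * hS₁G + ((-1) * G * h₀ + (-1) * G * F)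
    * hX + (X * G * h₀ * h₁) * hm

end Obstruction

end Summit.Ventures.HSemireg.DegreeSixSecondDigit
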